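import Literature.MathematicalPhysics.QuantumFieldTheory.BalabanImbrieJaffe1984to88.BIJ88Sect5StatementsPart4

/-!
# `BalabanImbrieJaffe1984to88.BIJ88Ineq593Proof` — T. Bałaban, J. Imbrie, A. Jaffe, *Effective action and cluster
properties of the abelian Higgs model*, Commun. Math. Phys. **114** (1988) 257–315 [BalabanImbrieJaffe1988]:
**(5.9.3)** p. 296, THE PRINTED FIRST STEP, PROVED — *"Next, we wish to prove that |u_{k+1}(⟨b₋,b₊⟩)ψ(b₊) − ψ(b₋)| ≡
|(D_{ū_{k+1}}ψ)(b)| ≤ cp(e_k), b ∈ Λ₀^{(k)′*}. (5.9.3) We prove the bound first for D_{ū_k}ψ (before the gauge transformation of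
Sect. 5). Our bounds on ψ − Q(u_k)φ reduce this to estimating |u_k(Γ_{b₋,x})φ(x) − u_k(⟨b₋,b₊⟩)u_k(Γ_{b₊,x′})φ(x′)| for any
x ∈ B(b₋), x′ ∈ B(b₊). This is proven with several applications of our bounds on D_{ū_k}φ."* — on the CONCRETE contour carrier of
`BIJ88Sect3Statements` (`Contour`, `transport`, `IsPath`, `covD`) and the covariant block average `BIJ88Sect5StatementsPart4.covAvg`
(kind «model-instance» for the typed leaf `BIJ88Sect5StatementsPart2.Ineq593`).

statement-level skeleton of published theorems with citation tags; proofs where landed; nothing here is a claim about the Yang–Mills mass gap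

PDF held: `paper:balaban1988-cmp114-bij-abelian-higgs-effective-action` (journal page = PDF page + 256).  Page read as image:
PDF p. 40 (journal 296), `g4png.py` ×2 render `HOME/lit-balaban-r16/renders/cmp114/original-p040-x2.png`.

CITATION HEADER (lean-in-tree rule).  Part of the lit-balaban TYPED SKELETON (HOME `run/shared/lean/pub/lit-balaban/`), Phase 2,
seat p36 (gen 3, unit `lit-balaban-p36`); row **C2.Eq5.9.3** of `HOME/lit-balaban-r16/ROWS-C2-part2.md` (leaf typed p240155 by r16).
WHAT IS REPRODUCED, and how (theorem-only; `u` a unimodular ℂ-valued bond field on the torus `T_η` of `Balaban1983to89.Setup`, the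
block field `ψ` on an abstract type `κ` of coarse sites `y` with blocks `B(y) ⊂ T_η`, the contours `Γ_{y,x}` of [2] Chap. 2 and the
straight lines `⟨b₋,b₊⟩` entering as contour DATA with their `IsPath` clauses — their construction in [2] is not repeated):
* §1 CONTOUR ALGEBRA on `BIJ88Sect3Statements.Contour`: transport of a concatenation / of the reversed contour (`transport_append`,
  `transport_reverse`), `IsPath` under concatenation and reversal (`isPath_append`, `isPath_reverse`), `‖u(Γ)‖ = 1`.
* §2 **THE COVARIANT TELESCOPING LEMMA** (*"several applications of our bounds on D_{ū_k}φ"*): for `Γ` a lattice curve from `y`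
  to `x`, `‖u(Γ)φ(x) − φ(y)‖ ≤ Σ_{b∈Γ} ‖(D_uφ)(b)‖` with `D_uφ(b) = u(b)φ(b₊) − φ(b₋) = BIJ88Sect3Statements.covD 1 u φ b`
  (`norm_transport_mul_sub_le`) — along a PATH, so no smallness of the field strength is needed.
* §3 the reduction *"Our bounds on ψ − Q(u_k)φ reduce this to estimating …"*: with `(Q(u)φ)(y) = Σ_{x∈B(y)} w·u(Γ_{y,x})φ(x)`
  (`covAvg`, `|B(y)|·w = 1`) the averaging identity `ū(Qφ)(y′) − (Qφ)(y) = Σ_{x,x′} w²[ū u(Γ_{y′,x′})φ(x′) − u(Γ_{y,x})φ(x)]`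
  (`avg_identity`), and `ū u(Γ_{y′,x′})φ(x′) − u(Γ_{y,x})φ(x) = u(Γ_{y,x})·[u(Γ_{y,x}⁻¹ ∘ ⟨b₋,b₊⟩ ∘ Γ_{y′,x′})φ(x′) − φ(x)]`, a transport
  along the PATH `x → b₋ → b₊ → x′`; hence **`norm_covD_psi_le`**: `|(D_ūψ)(b)| ≤ 2p₁ + p₃` from `|ψ − Q(u)φ| ≤ p₁` at `b₋, b₊` and the
  telescoping sums `≤ p₃` along those paths; with `|D_uφ| ≤ c₂p(e_k)` on the paths' bonds, `|ψ − Q(u)φ| ≤ c₁p(e_k)` and path lengths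
  `≤ n₀`: **`ineq593_first : Ineq593 CB inRegion (D_ūψ) (2c₁ + n₀c₂) p(e_k)`** (constants explicit; `c = 2c₁ + n₀c₂ = O(1)` since the
  contours of [2] have length `O(dL)`).
NOT here (prose in print, not claimed): the passage `u_k → u_{k+1}` (*"we make errors of the order of ce_kp(e_k)³λ_k^{−1/4} …"*,
pp. 296–297) and the insertion of `χ_{k+1,Λ₀^{(k)′}}`; no new `Prop` facts; axioms standard.
-/

namespace Literature.MathematicalPhysics.QuantumFieldTheory.BalabanImbrieJaffe1984to88.BIJ88Ineq593Proof

open Literature.MathematicalPhysics.QuantumFieldTheory.Balaban1983to89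
open BIJ88Sect3Statements BIJ88Sect5StatementsPart2 BIJ88Sect5StatementsPart4
open Complex

variable {P : Params} {j : ℕ}

/-! ## §1 Contour algebra -/

/-- transport along the empty contour. [cite: BalabanImbrieJaffe1988, (1.1) p.258] -/
@[simp] theorem transport_nil (u : PBond P j → ℂ) : transport u [] = 1 := by
  simp [transport]

/-- transport along `s :: γ` = the factor of `s` times the transport along `γ`. [cite: BalabanImbrieJaffe1988, (1.1) p.258] -/
theorem transport_cons (u : PBond P j → ℂ) (s : PBond P j × Bool) (γ : Contour P j) :
    transport u (s :: γ) = (if s.2 then u s.1 else (starRingEnd ℂ) (u s.1)) * transport u γ := by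
  simp [transport]

/-- transport is multiplicative under concatenation of contours. [cite: BalabanImbrieJaffe1988, (1.1) p.258] -/
theorem transport_append (u : PBond P j → ℂ) (γ₁ γ₂ : Contour P j) :
    transport u (γ₁ ++ γ₂) = transport u γ₁ * transport u γ₂ := by
  simp [transport, List.map_append, List.prod_append]

/-- transport along the REVERSED contour (bonds in reverse order, orientations flipped) is the complex conjugate.
[cite: BalabanImbrieJaffe1988, (1.1) p.258] -/
theorem transport_reverse (u : PBond P j → ℂ) :
    ∀ γ : Contour P j, transport u (γ.reverse.map fun s => (s.1, !s.2)) = (starRingEnd ℂ) (transport u γ)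
  | [] => by simp [transport]
  | s :: γ => by
    have ih := transport_reverse u γ
    rw [List.reverse_cons, List.map_append, transport_append, ih, transport_cons, map_mul]
    rcases s with ⟨b, sgn⟩
    cases sgn <;> simp [transport, mul_comm]

/-- `‖u(γ)‖ = 1` for a unimodular bond field. [cite: BalabanImbrieJaffe1988, (1.1) p.258] -/
theorem norm_transport (u : PBond P j → ℂ) (hu : ∀ b, ‖u b‖ = 1) : ∀ γ : Contour P j, ‖transport u γ‖ = 1
  | [] => by simp
  | s :: γ => by
    rw [transport_cons, norm_mul, norm_transport u hu γ, mul_one]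
    split_ifs <;> simp [hu]

/-- the initial site of the flipped segment is the final site of the segment. [cite: BalabanImbrieJaffe1988, (1.2) p.258] -/
theorem segStart_flip (s : PBond P j × Bool) : segStart (s.1, !s.2) = segEnd s := by
  rcases s with ⟨b, sgn⟩; cases sgn <;> rfl

/-- the final site of the flipped segment is the initial site of the segment. [cite: BalabanImbrieJaffe1988, (1.2) p.258] -/
theorem segEnd_flip (s : PBond P j × Bool) : segEnd (s.1, !s.2) = segStart s := by
  rcases s with ⟨b, sgn⟩; cases sgn <;> rfl

/-- `IsPath x [] y ↔ x = y`. [cite: BalabanImbrieJaffe1988, (1.2) p.258] -/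
theorem isPath_nil {x y : Balaban1983to89.Site P j} : IsPath x ([] : Contour P j) y ↔ x = y := Iff.rfl

/-- `IsPath x (s :: γ) y ↔ segStart s = x ∧ IsPath (segEnd s) γ y`. [cite: BalabanImbrieJaffe1988, (1.2) p.258] -/
theorem isPath_cons {x y : Balaban1983to89.Site P j} {s : PBond P j × Bool} {γ : Contour P j} :
    IsPath x (s :: γ) y ↔ segStart s = x ∧ IsPath (segEnd s) γ y := Iff.rfl

/-- a curve from `x` to `y` followed by a curve from `y` to `z` is a curve from `x` to `z`. [cite: BalabanImbrieJaffe1988, (1.2) p.258] -/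
theorem isPath_append {y z : Balaban1983to89.Site P j} {γ₂ : Contour P j} (h₂ : IsPath y γ₂ z) :
    ∀ {γ₁ : Contour P j} {x : Balaban1983to89.Site P j}, IsPath x γ₁ y → IsPath x (γ₁ ++ γ₂) z
  | [], x, h₁ => by
    have hx : x = y := isPath_nil.mp h₁
    subst hx
    simpa using h₂
  | s :: γ₁, x, h₁ => by
    obtain ⟨hs, hγ⟩ := isPath_cons.mp h₁
    exact isPath_cons.mpr ⟨hs, isPath_append h₂ hγ⟩

/-- the reversed curve runs from `y` back to `x`. [cite: BalabanImbrieJaffe1988, (1.2) p.258] -/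
theorem isPath_reverse : ∀ {γ : Contour P j} {x y : Balaban1983to89.Site P j}, IsPath x γ y → IsPath y (γ.reverse.map fun s => (s.1, !s.2)) x
  | [], x, y, h => by
    have hx : x = y := isPath_nil.mp h
    subst hx
    exact isPath_nil.mpr rfl
  | s :: γ, x, y, h => by
    obtain ⟨hs, hγ⟩ := isPath_cons.mp h
    rw [List.reverse_cons, List.map_append, List.map_cons, List.map_nil]
    refine isPath_append ?_ (isPath_reverse hγ)
    exact isPath_cons.mpr ⟨segStart_flip s, by rw [isPath_nil, segEnd_flip, hs]⟩

/-! ## §2 The covariant telescoping lemma -/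

/-- `‖D_uφ(b)‖` with `D_uφ = covD 1 u φ`: `‖covD 1 u φ b‖ = ‖u(b)φ(b₊) − φ(b₋)‖`. [cite: BalabanImbrieJaffe1988, (5.9.3) p.296] -/
theorem norm_covD_one (u : PBond P j → ℂ) (φ : Balaban1983to89.Site P j → ℂ) (b : PBond P j) :
    ‖covD 1 u φ b‖ = ‖u b * φ b.tgt - φ b.src‖ := by
  simp [covD]

/-- one step, either orientation: the segment factor `f` (`u(b)` or `conj u(b)`) satisfies
`‖f·φ(end) − φ(start)‖ = ‖u(b)φ(b₊) − φ(b₋)‖` for unimodular `u`. [cite: BalabanImbrieJaffe1988, (5.9.3) p.296] -/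
theorem norm_seg_eq (u : PBond P j → ℂ) (hu : ∀ b, ‖u b‖ = 1) (φ : Balaban1983to89.Site P j → ℂ) (s : PBond P j × Bool) :
    ‖(if s.2 then u s.1 else (starRingEnd ℂ) (u s.1)) * φ (segEnd s) - φ (segStart s)‖ = ‖u s.1 * φ s.1.tgt - φ s.1.src‖ := by
  rcases s with ⟨b, sgn⟩
  cases sgn
  · simp only [segStart, segEnd, Bool.false_eq_true, ↓reduceIte]
    have hmc : u b * (starRingEnd ℂ) (u b) = 1 := by
      rw [Complex.mul_conj, Complex.normSq_eq_norm_sq, hu]; simp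
    calc ‖(starRingEnd ℂ) (u b) * φ b.src - φ b.tgt‖
        = ‖u b‖ * ‖(starRingEnd ℂ) (u b) * φ b.src - φ b.tgt‖ := by rw [hu, one_mul]
      _ = ‖u b * ((starRingEnd ℂ) (u b) * φ b.src - φ b.tgt)‖ := (norm_mul _ _).symm
      _ = ‖φ b.src - u b * φ b.tgt‖ := by rw [mul_sub, ← mul_assoc, hmc, one_mul]
      _ = ‖u b * φ b.tgt - φ b.src‖ := norm_sub_rev _ _
  · simp [segStart, segEnd]

/-- **THE COVARIANT TELESCOPING LEMMA**: for a unimodular bond field `u` and a lattice curve `Γ` from `y` to `x`,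
`‖u(Γ)φ(x) − φ(y)‖ ≤ Σ_{b∈Γ} ‖(D_uφ)(b)‖` — *"several applications of our bounds on D_{ū_k}φ"* (p. 296), made into one inequality.
[cite: BalabanImbrieJaffe1988, (5.9.3) p.296] -/
theorem norm_transport_mul_sub_le (u : PBond P j → ℂ) (hu : ∀ b, ‖u b‖ = 1) (φ : Balaban1983to89.Site P j → ℂ) :
    ∀ (γ : Contour P j) (y x : Balaban1983to89.Site P j), IsPath y γ x →
      ‖transport u γ * φ x - φ y‖ ≤ (γ.map fun s => ‖covD 1 u φ s.1‖).sum
  | [], y, x, h => by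
    have hy : y = x := isPath_nil.mp h
    subst hy
    simp
  | s :: γ, y, x, h => by
    obtain ⟨hs, hγ⟩ := isPath_cons.mp h
    have ih := norm_transport_mul_sub_le u hu φ γ (segEnd s) x hγ
    rw [transport_cons, List.map_cons, List.sum_cons, norm_covD_one, ← norm_seg_eq u hu φ s, hs]
    set f : ℂ := if s.2 then u s.1 else (starRingEnd ℂ) (u s.1) with hf
    have hfn : ‖f‖ = 1 := by rw [hf]; split_ifs <;> simp [hu]
    have hsplit : f * transport u γ * φ x - φ y = f * (transport u γ * φ x - φ (segEnd s)) + (f * φ (segEnd s) - φ y) := by ring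
    rw [hsplit]
    refine (norm_add_le _ _).trans ?_
    rw [norm_mul, hfn, one_mul, add_comm]
    exact add_le_add le_rfl ih

/-! ## §3 The reduction to the telescoping sums and the bound on `D_ūψ` -/

section Blocks

variable {κ : Type*}

/-- the AVERAGING IDENTITY behind *"reduce this to estimating … for any x ∈ B(b₋), x′ ∈ B(b₊)"*: for blocks with `|B(y)|·w = 1 =
|B(y′)|·w`, `ū·Σ_{x′∈B(y′)} w a(x′) − Σ_{x∈B(y)} w b(x) = Σ_{x∈B(y)}Σ_{x′∈B(y′)} w²(ū a(x′) − b(x))`.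
[cite: BalabanImbrieJaffe1988, (5.9.3) p.296] -/
theorem avg_identity (s t : Finset (Balaban1983to89.Site P j)) (w : ℝ) (hs : (s.card : ℝ) * w = 1) (ht : (t.card : ℝ) * w = 1)
    (a b : Balaban1983to89.Site P j → ℂ) (c : ℂ) :
    c * (∑ x' ∈ t, (w : ℂ) * a x') - ∑ x ∈ s, (w : ℂ) * b x = ∑ x ∈ s, ∑ x' ∈ t, (w : ℂ) * (w : ℂ) * (c * a x' - b x) := by
  have hs' : (s.card : ℂ) * (w : ℂ) = 1 := by exact_mod_cast hs
  have ht' : (t.card : ℂ) * (w : ℂ) = 1 := by exact_mod_cast ht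
  have h1 : ∑ x ∈ s, ∑ x' ∈ t, (w : ℂ) * (w : ℂ) * (c * a x') = c * ∑ x' ∈ t, (w : ℂ) * a x' := by
    rw [Finset.sum_const, nsmul_eq_mul, Finset.mul_sum, Finset.mul_sum]
    refine Finset.sum_congr rfl fun x' _ => ?_
    calc (s.card : ℂ) * ((w : ℂ) * (w : ℂ) * (c * a x')) = ((s.card : ℂ) * (w : ℂ)) * ((w : ℂ) * (c * a x')) := by ring
      _ = c * ((w : ℂ) * a x') := by rw [hs', one_mul]; ring
  have h2 : ∑ x ∈ s, ∑ x' ∈ t, (w : ℂ) * (w : ℂ) * b x = ∑ x ∈ s, (w : ℂ) * b x := by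
    refine Finset.sum_congr rfl fun x _ => ?_
    rw [Finset.sum_const, nsmul_eq_mul]
    calc (t.card : ℂ) * ((w : ℂ) * (w : ℂ) * b x) = ((t.card : ℂ) * (w : ℂ)) * ((w : ℂ) * b x) := by ring
      _ = (w : ℂ) * b x := by rw [ht', one_mul]
  simp only [mul_sub, Finset.sum_sub_distrib, h1, h2]

/-- the PATH of the reduction: `Γ_{y,x}` reversed (from `x` to `b₋`), then the line `⟨b₋,b₊⟩`, then `Γ_{y′,x′}` (to `x′`) is a lattice
curve from `x` to `x′` along which `ū·u(Γ_{y′,x′})` and `u(Γ_{y,x})` are compared. [cite: BalabanImbrieJaffe1988, (5.9.3) p.296] -/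
theorem isPath_reduction {by_ by' x x' : Balaban1983to89.Site P j} {Γyx ℓ Γy'x' : Contour P j} (hΓ : IsPath by_ Γyx x)
    (hℓ : IsPath by_ ℓ by') (hΓ' : IsPath by' Γy'x' x') :
    IsPath x ((Γyx.reverse.map fun s => (s.1, !s.2)) ++ ℓ ++ Γy'x') x' :=
  isPath_append hΓ' (isPath_append hℓ (isPath_reverse hΓ))

/-- one pair `(x, x′)`: `‖ū u(Γ_{y′,x′})φ(x′) − u(Γ_{y,x})φ(x)‖ ≤ Σ_{b ∈ path} ‖D_uφ(b)‖` — *"estimating |u_k(Γ_{b₋,x})φ(x) −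
u_k(⟨b₋,b₊⟩)u_k(Γ_{b₊,x′})φ(x′)| … with several applications of our bounds on D_{ū_k}φ"*. [cite: BalabanImbrieJaffe1988, (5.9.3) p.296] -/
theorem norm_pair_le (u : PBond P j → ℂ) (hu : ∀ b, ‖u b‖ = 1) (φ : Balaban1983to89.Site P j → ℂ) {by_ by' x x' : Balaban1983to89.Site P j}
    {Γyx ℓ Γy'x' : Contour P j} (hΓ : IsPath by_ Γyx x) (hℓ : IsPath by_ ℓ by') (hΓ' : IsPath by' Γy'x' x') :
    ‖transport u ℓ * (transport u Γy'x' * φ x') - transport u Γyx * φ x‖ ≤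
      (((Γyx.reverse.map fun s => (s.1, !s.2)) ++ ℓ ++ Γy'x').map fun s => ‖covD 1 u φ s.1‖).sum := by
  have hpath := isPath_reduction hΓ hℓ hΓ'
  have htel := norm_transport_mul_sub_le u hu φ _ _ _ hpath
  rw [transport_append, transport_append, transport_reverse] at htel
  set T : ℂ := transport u Γyx with hT
  have hT1 : ‖T‖ = 1 := norm_transport u hu Γyx
  have hmc : T * (starRingEnd ℂ) T = 1 := by
    rw [Complex.mul_conj, Complex.normSq_eq_norm_sq, hT1]; simp
  have key : transport u ℓ * (transport u Γy'x' * φ x') - T * φ x =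
      T * ((starRingEnd ℂ) T * transport u ℓ * transport u Γy'x' * φ x' - φ x) := by
    calc transport u ℓ * (transport u Γy'x' * φ x') - T * φ x
        = (T * (starRingEnd ℂ) T) * (transport u ℓ * transport u Γy'x' * φ x') - T * φ x := by rw [hmc, one_mul]; ring
      _ = T * ((starRingEnd ℂ) T * transport u ℓ * transport u Γy'x' * φ x' - φ x) := by ring
  rw [key, norm_mul, hT1, one_mul]
  exact htel

/-- **THE BOUND ON `D_ūψ`** (*"We prove the bound first for D_{ū_k}ψ"*): for the coarse bond with endpoints `y, y′` (base points
`b₋ = base y`, `b₊ = base y′` in `T_η`), `ū = u(⟨b₋,b₊⟩)` the transport along the line `ℓ`, blocks `B(y), B(y′)` with `|B|·w = 1`,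
contours `Γ_{y,x}` from `base y` to `x ∈ B(y)`, the covariant block average `(Q(u)φ)(y) = Σ_{x∈B(y)} w u(Γ_{y,x})φ(x)` (`covAvg`):
if `‖ψ − Q(u)φ‖ ≤ p₁` at `y, y′` and the telescoping sums along the reduction paths are `≤ p₃`, then `‖ūψ(y′) − ψ(y)‖ ≤ 2p₁ + p₃`.
[cite: BalabanImbrieJaffe1988, (5.9.3) p.296] -/
theorem norm_covD_psi_le (u : PBond P j → ℂ) (hu : ∀ b, ‖u b‖ = 1) (φ : Balaban1983to89.Site P j → ℂ) (B : κ → Finset (Balaban1983to89.Site P j)) (w : ℝ)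
    (hw : 0 ≤ w) (base : κ → Balaban1983to89.Site P j) (Γ : κ → Balaban1983to89.Site P j → Contour P j) (ψ : κ → ℂ) {y y' : κ} (ℓ : Contour P j)
    (hBy : ((B y).card : ℝ) * w = 1) (hBy' : ((B y').card : ℝ) * w = 1)
    (hΓy : ∀ x ∈ B y, IsPath (base y) (Γ y x) x) (hΓy' : ∀ x' ∈ B y', IsPath (base y') (Γ y' x') x')
    (hℓ : IsPath (base y) ℓ (base y')) {p₁ p₃ : ℝ}
    (hψy : ‖ψ y - covAvg B w (fun z x => transport u (Γ z x)) φ y‖ ≤ p₁)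
    (hψy' : ‖ψ y' - covAvg B w (fun z x => transport u (Γ z x)) φ y'‖ ≤ p₁)
    (hD : ∀ x ∈ B y, ∀ x' ∈ B y',
      ((((Γ y x).reverse.map fun s => (s.1, !s.2)) ++ ℓ ++ Γ y' x').map fun s => ‖covD 1 u φ s.1‖).sum ≤ p₃) :
    ‖transport u ℓ * ψ y' - ψ y‖ ≤ 2 * p₁ + p₃ := by
  set Qy : ℂ := covAvg B w (fun z x => transport u (Γ z x)) φ y with hQy
  set Qy' : ℂ := covAvg B w (fun z x => transport u (Γ z x)) φ y' with hQy'
  have hsplit : transport u ℓ * ψ y' - ψ y = transport u ℓ * (ψ y' - Qy') + (transport u ℓ * Qy' - Qy) + (Qy - ψ y) := by ring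
  -- the middle term: averaging identity + pairwise telescoping
  have hmid : ‖transport u ℓ * Qy' - Qy‖ ≤ p₃ := by
    have hid := avg_identity (B y) (B y') w hBy hBy' (fun x' => transport u (Γ y' x') * φ x')
      (fun x => transport u (Γ y x) * φ x) (transport u ℓ)
    have hQy_eq : Qy = ∑ x ∈ B y, (w : ℂ) * (transport u (Γ y x) * φ x) := by
      rw [hQy]; unfold covAvg; exact Finset.sum_congr rfl fun x _ => by ring
    have hQy'_eq : Qy' = ∑ x' ∈ B y', (w : ℂ) * (transport u (Γ y' x') * φ x') := by
      rw [hQy']; unfold covAvg; exact Finset.sum_congr rfl fun x _ => by ring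
    rw [hQy_eq, hQy'_eq, hid]
    calc ‖∑ x ∈ B y, ∑ x' ∈ B y', (w : ℂ) * (w : ℂ) *
            (transport u ℓ * (transport u (Γ y' x') * φ x') - transport u (Γ y x) * φ x)‖
        ≤ ∑ x ∈ B y, ‖∑ x' ∈ B y', (w : ℂ) * (w : ℂ) *
            (transport u ℓ * (transport u (Γ y' x') * φ x') - transport u (Γ y x) * φ x)‖ := norm_sum_le _ _
      _ ≤ ∑ x ∈ B y, ∑ x' ∈ B y', w * w * p₃ := by
          refine Finset.sum_le_sum fun x hx => (norm_sum_le _ _).trans (Finset.sum_le_sum fun x' hx' => ?_)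
          rw [norm_mul, norm_mul, Complex.norm_real, Real.norm_of_nonneg hw]
          exact mul_le_mul_of_nonneg_left ((norm_pair_le u hu φ (hΓy x hx) hℓ (hΓy' x' hx')).trans (hD x hx x' hx'))
            (mul_nonneg hw hw)
      _ = (((B y).card : ℝ) * w) * (((B y').card : ℝ) * w) * p₃ := by
          rw [Finset.sum_const, Finset.sum_const, nsmul_eq_mul, nsmul_eq_mul]; ring
      _ = p₃ := by rw [hBy, hBy', one_mul, one_mul]
  have hp₁ : 0 ≤ p₁ := (norm_nonneg _).trans hψy
  rw [hsplit]
  calc ‖transport u ℓ * (ψ y' - Qy') + (transport u ℓ * Qy' - Qy) + (Qy - ψ y)‖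
      ≤ ‖transport u ℓ * (ψ y' - Qy')‖ + ‖transport u ℓ * Qy' - Qy‖ + ‖Qy - ψ y‖ := norm_add₃_le
    _ ≤ p₁ + p₃ + p₁ := by
        refine add_le_add (add_le_add ?_ hmid) ?_
        · rw [norm_mul, norm_transport u hu ℓ, one_mul]; exact hψy'
        · rw [norm_sub_rev]; exact hψy
    _ = 2 * p₁ + p₃ := by ring

end Blocks

/-! ## §4 (5.9.3), the first step, as `Ineq593` -/

section Main

variable {κ CB : Type}

/-- **(5.9.3), the printed first step**: with coarse bonds `b` (`src b = b₋`, `tgt b = b₊` coarse sites, `line b` = the straight line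
`⟨b₋,b₊⟩` in `T_η`), `(D_ūψ)(b) = ū(b)ψ(b₊) − ψ(b₋)`, blocks with `|B|·w = 1`, contours with their `IsPath` clauses and lengths `≤ n_Γ`,
lines of length `≤ n_ℓ`: if on the region `|ψ − Q(u)φ| ≤ c₁p(e_k)` at both endpoints and `|D_uφ| ≤ c₂p(e_k)` on every bond of the
reduction paths (the restrictions (5.2.2)), then `|(D_ūψ)(b)| ≤ (2c₁ + (2n_Γ + n_ℓ)c₂)·p(e_k)` — `Ineq593` with the explicit `c`.
[cite: BalabanImbrieJaffe1988, (5.9.3) p.296] -/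
theorem ineq593_first (u : PBond P j → ℂ) (hu : ∀ b, ‖u b‖ = 1) (φ : Balaban1983to89.Site P j → ℂ) (B : κ → Finset (Balaban1983to89.Site P j)) (w : ℝ)
    (hw : 0 ≤ w) (base : κ → Balaban1983to89.Site P j) (Γ : κ → Balaban1983to89.Site P j → Contour P j) (ψ : κ → ℂ) (src tgt : CB → κ)
    (line : CB → Contour P j) (inRegion : CB → Prop) {c₁ c₂ pek : ℝ} {nΓ nℓ : ℕ} (hpek : 0 ≤ pek) (hc₂ : 0 ≤ c₂)
    (hB : ∀ b, inRegion b → ((B (src b)).card : ℝ) * w = 1 ∧ ((B (tgt b)).card : ℝ) * w = 1)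
    (hΓ : ∀ z, ∀ x ∈ B z, IsPath (base z) (Γ z x) x) (hlenΓ : ∀ z, ∀ x ∈ B z, (Γ z x).length ≤ nΓ)
    (hline : ∀ b, inRegion b → IsPath (base (src b)) (line b) (base (tgt b))) (hlenℓ : ∀ b, inRegion b → (line b).length ≤ nℓ)
    (hψ : ∀ b, inRegion b →
      ‖ψ (src b) - covAvg B w (fun z x => transport u (Γ z x)) φ (src b)‖ ≤ c₁ * pek ∧
      ‖ψ (tgt b) - covAvg B w (fun z x => transport u (Γ z x)) φ (tgt b)‖ ≤ c₁ * pek)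
    (hφ : ∀ b, inRegion b → ∀ x ∈ B (src b), ∀ x' ∈ B (tgt b),
      ∀ s ∈ ((Γ (src b) x).reverse.map fun s => (s.1, !s.2)) ++ line b ++ Γ (tgt b) x', ‖covD 1 u φ s.1‖ ≤ c₂ * pek) :
    Ineq593 CB inRegion (fun b => transport u (line b) * ψ (tgt b) - ψ (src b)) (2 * c₁ + (2 * nΓ + nℓ) * c₂) pek := by
  intro b hb
  obtain ⟨hBs, hBt⟩ := hB b hb
  obtain ⟨hψs, hψt⟩ := hψ b hb
  have hmain := norm_covD_psi_le u hu φ B w hw base Γ ψ (line b) hBs hBt (hΓ (src b)) (hΓ (tgt b)) (hline b hb)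
    (p₃ := (2 * nΓ + nℓ) * (c₂ * pek)) hψs hψt ?_
  · refine hmain.trans (le_of_eq (by ring))
  · intro x hx x' hx'
    set path := ((Γ (src b) x).reverse.map fun s => (s.1, !s.2)) ++ line b ++ Γ (tgt b) x' with hpath
    have hlen : path.length ≤ 2 * nΓ + nℓ := by
      rw [hpath, List.length_append, List.length_append, List.length_map, List.length_reverse]
      have h1 := hlenΓ (src b) x hx
      have h2 := hlenΓ (tgt b) x' hx'
      have h3 := hlenℓ b hb
      omega
    have hsum := List.sum_le_card_nsmul (path.map fun s => ‖covD 1 u φ s.1‖) (c₂ * pek) (by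
      intro a ha
      obtain ⟨s, hs, rfl⟩ := List.mem_map.mp ha
      exact hφ b hb x hx x' hx' s hs)
    rw [List.length_map, nsmul_eq_mul] at hsum
    refine hsum.trans ?_
    have : (path.length : ℝ) ≤ (2 * nΓ + nℓ : ℕ) := by exact_mod_cast hlen
    push_cast at this
    exact mul_le_mul_of_nonneg_right this (mul_nonneg hc₂ hpek)

end Main

end Literature.MathematicalPhysics.QuantumFieldTheory.BalabanImbrieJaffe1984to88.BIJ88Ineq593Proof
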